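import Summits.BirchSwinnertonDyer.Rank1Residual.GaloisImage.KolyvaginLevelOneUnitCaseOfDictionary
import Summits.BirchSwinnertonDyer.Rank1Residual.X11b.KummerRelaxedStructures
import Literature.NumberTheory.GaloisCohomology.PoitouTateSelmerStructures
import HarnessLib

/-!
# The EXOTIC unit case END THEOREM with NAMED FACTS ONLY and WITHOUT Gross–Zagier–Kolyvagin:
# `#Sel^(p)(E/ℚ) = 1 ∧ r_an = 0 ∧ ord_p #Ш_an = 0 ⟹ BSD(E,p)` GZK-free, and
# `bsdp_three_of_dictionaryOne_of_facts` (PT family ↦ one fact; `S`, `[Finite E[3]]`, `hGZK` discharged)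
# (cell `b2b-bsdres`, team n1011, row T-a5x-II (II.2); seat p13)

HONEST FRAMING (cell `b2b-bsdres`, run/shared/lean/b2b/bsd-rank1-residual/, verbatim in every
file): the goal of the cell is to DELETE the COMBINATION-SHAPED residual classes of the
Birch–Swinnerton-Dyer formula for ALL analytic-rank `≤ 1` elliptic curves over `ℚ` — "full BSD
formula for every rank `≤ 1` curve in class `C`" assembled STRICTLY from published theorems — so
that the rank-`≤ 1` remainder becomes exactly the CONSTRUCTION-SHAPED classes, which are TYPED
(missing-input `Prop`s), NOT attempted. This is not "finishing BSD". Team n1011 (N10/N11, the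
additive block `X4 ∧ p = 3`): research route; no claim beyond the stated classes; the label X4 and
the mark of RESIDUAL-MAP §I N11 are UNCHANGED by this file; nothing is booked. Theorems only:
no definition, no named fact; EXOTIC rows stay REDUCED (to the PORT DICT3₁ + named facts), none
is closed.

## What and why

p271070 `bsdp_three_of_dictionaryOne` (the EXOTIC unit case END TO END from the level-one
dictionary DICT3₁) carries, besides the PORT `KatoKuriharaDictionaryThreeOneAt W 0 D v₃` and the row
conditions: THREE named facts (`hS24`, `hS24₂`, `hGZK`), the Poitou–Tate family as DATA plus FOUR
hypotheses (`inv`, `hperf`, `hsum`, `hunro`, `hcompl`), Tate's `hEP`, an admissible `S` with THREE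
membership hypotheses, and the instance `[Finite E[3]]`.  This file removes what the tree already
knows (all but the instance binder, which the STATEMENT needs: `HasCanonicalComparison` and the
PORT are typed over the `𝔽₃`-module `E[3]`; any caller discharges it by `finite_torsionPoints_holds`):

* **`bsdp_of_card_selmerGroup_eq_one_of_analyticRank_eq_zero`** — the `p`-SELMER CERTIFICATE
  CONSUMER IN ANALYTIC RANK `0` WITHOUT GROSS–ZAGIER–KOLYVAGIN (any `E/ℚ`, any prime `p`):
  `#Sel^(p)(E/ℚ) = 1 ∧ r_an = 0 ∧ #Ш_an = q ∧ ord_p q = 0 ⟹ BSD(E,p)`.  The PROVED Kummer sequence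
  (`selmer_exact_holds`: `E(ℚ)/pE(ℚ) ≅ im κ ≤ Sel^(p)`) and Mordell–Weil (`module_finite_point_holds`,
  `pow_finrank_dvd_natCard_quotient_range_zsmul`: `p^rank ∣ #(E(ℚ)/pE(ℚ))`) give `p^rank ∣ 1`, so
  `rank_ℤ E(ℚ) = 0 = r_an`; `noPTorsion_of_card_selmerGroup_eq_pow_rank` (at rank `0`) gives
  `Ш[p] = 0`, hence `Ш(p) = ⊥` (`primaryComponent_sha_eq_bot_of_noPTorsion`: an element of order
  `p^(k+1)` has a multiple of order `p`), finite, with `ord_p #Ш(p) = 0 = ord_p q`.  The tree's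
  `Typed.bsdp_of_card_selmerGroup_eq_pow_analyticRank` / p13's p249557
  `X4RankZero.bsdp_three_of_card_selmerThree_eq_one` prove the same with `hGZK`; at `r_an = 0` the
  certificate itself makes GZK redundant.
* **`bsdp_three_of_dictionaryOne_of_facts`** — p271070's end theorem with: `hGZK` DELETED;
  `(inv) (hperf) (hsum) (hunro) (hcompl)` ↦ ONE named fact
  `(hPT : poitouTate_selmerStructure_duality ℚ)` (PoitouTateSelmerStructures.lean: ONE family with all
  four properties — Milne I 2.3 / 2.6 / 4.10, Howard 2.1.11; `inv` enters no other binder).  Chain: DICT3₁ → Kato classes (p271070's three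
  lines) → p266233 `apply_empty_not_mem_selmerGroup_kummer_of_dictionary` → p265535
  `natCard_selmerGroup_three_eq_one_of_levelOne_certificate` (already GZK-free) → the consumer above.
* **`exists_kolyvaginDatum_bsdp_three_of_dictionaryOne_of_facts`** — `S` (x11b
  `KummerPT.exists_exceptional_finset`), `τ` (p260356), `η`, `D` (p04 T-HCC) and `v₃` discharged
  existentially: from the named facts `hS24`, `hS24₂`, `hPT`, `hEP`, the row conditions and the
  modular-parametrisation data ALONE, there are `S, τ, η, D, v₃` (with their defining clauses) such
  that DICT3₁ `KatoKuriharaDictionaryThreeOneAt W 0 D v₃` implies `BSD(E, 3)`.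

* `propagatedSelmerStructure_three_zero`, **`katoKuriharaDictionaryThreeAt_zero_iff_threeOneAt`**
  (`Iff.rfl`) — ONE PORT, TWO SPELLINGS as a kernel fact: n1011-p09's R1-21 port
  `KatoKuriharaDictionaryThreeAt W 0 t D v₃` (level spelling at `k = 0`) and p13's
  `KatoKuriharaDictionaryThreeOneAt W t D v₃` are DEFINITIONALLY the same proposition (route planner
  r1's rider R-a); `exists_kolyvaginDatum_bsdp_three_of_dictionaryAt_zero_of_facts` reads the `∃`-form
  in p09's spelling.

BINDERS OF RECORD of the end theorem after this file (nothing hidden): named facts `hS24`, `hS24₂`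
([S24] Thm. 4.4 (1)(2)), `hPT` (Poitou–Tate / Milne–Howard), `hEP` (Tate's local Euler–Poincaré
characteristic) · row conditions `Addv W 3`, `¬3 ∣ c₃`, surj(3), `#E(ℚ₃)[3] = 1`, `r_an = 0`,
`#Ш_an = q ∧ ord₃ q = 0` · THE PORT DICT3₁ (flags `K22-Thm3.13-PORT@3`, `EXOTIC-Kato-integrality@3`)
· `P`, `3 ∤ c_P`, the period transfer, `[0]⁺ ≠ 0` · the instance `[Finite E[3]]`.  Versus
p271070: −1 named fact (GZK); `inv` + 4 hypotheses ↦ 1 fact; and in the `∃`-form also `S` + 3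
hypotheses discharged.  Nothing booked; no mark / label changed; EXOTIC rows REDUCED, none closed; the
corner EXOTIC ∧ `t = 1` untouched.

References: R. Sakamoto, JTNB 36 (2024) Thm. 4.4 [Sakamoto2024]; C.-H. Kim, AJM 148 (2026)
Thm. 3.13 [Kim2022StructureSelmer]; J. S. Milne, *Arithmetic Duality Theorems* I 2.3/2.6/4.10
[MilneADT2006]; B. Howard, Compositio 140 (2004) Thm. 2.1.11 [Howard2004HeegnerKolyvagin];
R. L. Miller, LMS JCM 14 (2011) Def. 1.1 [Miller2011LMS]; J. H. Silverman, *AEC* VIII.1, X.4.2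
[SilvermanAEC2009].
-/

noncomputable section

open scoped Classical NumberField ContRepresentation
open Field NumberField IsDedekindDomain
open WeierstrassCurve Literature.NumberTheory.EllipticCurves Literature.NumberTheory.EllipticCurves.ModularForms
  Literature.NumberTheory.EllipticCurves.Rank1Residual
  Literature.NumberTheory.EllipticCurves.Rank1Residual.Typed
  Literature.NumberTheory.GaloisRepresentations
  Literature.NumberTheory.GaloisRepresentations.DiscreteGaloisModule Literature.NumberTheory.GaloisCohomology
open Literature.NumberTheory.DiophantineGeometry.Dioph (ratModP)

namespace Summit.BirchSwinnertonDyer.Rank1Residual.GaloisImage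

/-! ### `#Sel^(p)(E/K) = 1` forces `rank_ℤ E(K) = 0` (any number field) -/

section GeneralRank

variable {K : Type*} [Field K] [NumberField K] (V : WeierstrassCurve K) [V.IsElliptic]

/-- **`#Sel^(p)(E/K) = 1 ⟹ rank_ℤ E(K) = 0`** over any number field, from the PROVED Kummer sequence
`E(K)/pE(K) ≅ im κ ≤ Sel^(p)(E/K)` (`selmer_exact_holds`, Silverman X.4.2) and Mordell–Weil
(`module_finite_point_holds`, `pow_finrank_dvd_natCard_quotient_range_zsmul`: `p^rank ∣ #(E(K)/pE(K))`):
`p^rank ∣ #im κ ∣ #Sel^(p) = 1`.  No Gross–Zagier–Kolyvagin.  (Same bookkeeping as the tree's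
`Typed.noPTorsion_of_card_selmerGroup_eq_pow_rank`.) [cite: SilvermanAEC2009, Thm X.4.2(a)] -/
theorem mordellWeilRank_eq_zero_of_card_selmerGroup_eq_one (p : ℕ) [hp : Fact p.Prime]
    (hsel : Nat.card (V.selmerGroup (p : ℤ)) = 1) : V.mordellWeilRank = 0 := by
  have hp0 : (p : ℤ) ≠ 0 := by exact_mod_cast hp.out.ne_zero
  obtain ⟨κ, hker, hrange, -⟩ := selmer_exact_holds V (p : ℤ) hp0
  haveI : Module.Finite ℤ V.toAffine.Point := V.module_finite_point_holds
  have hdvd1 : p ^ V.mordellWeilRank ∣ Nat.card κ.range := by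
    have h := pow_finrank_dvd_natCard_quotient_range_zsmul (A := V.toAffine.Point) p
    have hequiv : Nat.card (V.toAffine.Point ⧸
        (zsmulAddGroupHom (α := V.toAffine.Point) (p : ℤ)).range) = Nat.card κ.range := by
      rw [← hker]
      exact Nat.card_congr (QuotientAddGroup.quotientKerEquivRange κ).toEquiv
    rw [hequiv] at h
    exact h
  have hle : κ.range ≤ V.selmerGroup (p : ℤ) := by rw [hrange]; exact inf_le_left
  haveI : Finite (V.selmerGroup (p : ℤ)) := Nat.finite_of_card_ne_zero (by rw [hsel]; exact one_ne_zero)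
  have hdvd2 : Nat.card κ.range ∣ 1 := by
    have h := AddSubgroup.card_dvd_of_le hle
    rwa [hsel] at h
  have h1 : p ^ V.mordellWeilRank = 1 := Nat.dvd_one.mp (hdvd1.trans hdvd2)
  exact (Nat.pow_eq_one.mp h1).resolve_left hp.out.one_lt.ne'

end GeneralRank

variable (W : WeierstrassCurve ℚ) [W.IsElliptic]

/-! ### The `p`-Selmer certificate consumer in analytic rank `0`, without GZK -/

omit [W.IsElliptic] in
/-- **`Ш[p] = 0` forces `Ш(p) = ⊥`** (any `E/ℚ`, any prime `p`): an element of `Ш` of order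
`p^(k+1)` has a multiple of order `p`, which the hypothesis kills. [folklore] -/
theorem primaryComponent_sha_eq_bot_of_noPTorsion (p : ℕ) [hp : Fact p.Prime]
    (h : ∀ x : W.sha, (p : ℤ) • x = 0 → x = 0) :
    AddCommGroup.primaryComponent W.sha p = ⊥ := by
  refine (AddSubgroup.eq_bot_iff_forall _).mpr fun x hx => ?_
  obtain ⟨n, hn⟩ := (AddCommGroup.mem_primaryComponent_iff_addOrderOf (p := p)).mp hx
  induction n generalizing x with
  | zero =>
    rw [pow_zero] at hn
    exact AddMonoid.addOrderOf_eq_one_iff.mp hn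
  | succ k ih =>
    -- `y = p^k • x` has order `p`, so `p • y = 0` and `y = 0` by hypothesis: absurd
    exfalso
    have hy : addOrderOf (p ^ k • x) = p := by
      rw [addOrderOf_nsmul_of_dvd (pow_ne_zero k hp.out.ne_zero) (by rw [hn]; exact pow_dvd_pow p k.le_succ),
        hn, pow_succ, Nat.mul_div_cancel_left _ (pow_pos hp.out.pos k)]
    have hy0 : p ^ k • x = 0 := by
      refine h _ ?_
      rw [natCast_zsmul]
      have h0 := addOrderOf_nsmul_eq_zero (p ^ k • x)
      rwa [hy] at h0
    rw [hy0, addOrderOf_zero] at hy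
    exact hp.out.one_lt.ne hy

/-- **The `p`-Selmer certificate consumer in analytic rank `0`, WITHOUT Gross–Zagier–Kolyvagin.**
For `E = W/ℚ` of analytic rank `0` with `#Ш(E)_an = q`, `ord_p q = 0`, the certificate
`#Sel^(p)(E/ℚ) = 1` gives Miller's `BSD(E,p)` — all three clauses from the certificate: (i) rank:
the PROVED Kummer sequence `E(ℚ)/pE(ℚ) ≅ im κ ≤ Sel^(p)` (`selmer_exact_holds`, Silverman X.4.2) and
Mordell–Weil (`module_finite_point_holds`, `pow_finrank_dvd_natCard_quotient_range_zsmul`) give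
`p^rank ∣ #Sel^(p) = 1`, so `rank_ℤ E(ℚ) = 0 = r_an`; (ii)/(iv) `Ш[p] = 0`
(`noPTorsion_of_card_selmerGroup_eq_pow_rank` at rank `0`), so `Ш(p) = ⊥` is finite with
`ord_p #Ш(p) = 0 = ord_p #Ш_an`; (iii) `#Ш_an = q ∈ ℚ` is a hypothesis.  Compare the tree's
`Typed.bsdp_of_card_selmerGroup_eq_pow_analyticRank` (same conclusion WITH `hGZK` for rank and
finiteness): in analytic rank `0` the certificate makes GZK redundant.  Class-free; a per-curve
certificate consumer, not a class theorem. [cite: Miller2011LMS, §1 and Def. 1.1]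
[cite: SilvermanAEC2009, Thm X.4.2(a)] -/
theorem bsdp_of_card_selmerGroup_eq_one_of_analyticRank_eq_zero (p : ℕ) [hp : Fact p.Prime]
    (hr : W.analyticRank = 0) {q : ℚ} (hq : shaAn W = (q : ℂ)) (hv : padicValRat p q = 0)
    (hsel : Nat.card (W.selmerGroup (p : ℤ)) = 1) : BSDp W p := by
  -- (i) rank `0` from the certificate
  have hrank : W.mordellWeilRank = 0 := mordellWeilRank_eq_zero_of_card_selmerGroup_eq_one W p hsel
  -- (ii) `Ш[p] = 0`, hence `Ш(p) = ⊥`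
  have hnoP : ∀ x : W.sha, (p : ℤ) • x = 0 → x = 0 :=
    noPTorsion_of_card_selmerGroup_eq_pow_rank W p (by rw [hrank, pow_zero]; exact hsel)
  have hbot : AddCommGroup.primaryComponent W.sha p = ⊥ :=
    primaryComponent_sha_eq_bot_of_noPTorsion W p hnoP
  refine ⟨by rw [hrank, hr], ?_, q, hq, ?_⟩
  · rw [hbot]; infer_instance
  · rw [hv, hbot, AddSubgroup.card_bot, padicValNat_one_right, Nat.cast_zero]

/-! ### The EXOTIC unit case end theorem with named facts only -/

/-- **The EXOTIC unit case from DICT3 at level one — NAMED FACTS ONLY, NO GZK.**  p271070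
`bsdp_three_of_dictionaryOne` with: `hGZK` DELETED (the `3`-Selmer certificate produced by the chain
gives rank `0` and `Ш(3) = ⊥` by itself, `bsdp_of_card_selmerGroup_eq_one_of_analyticRank_eq_zero`);
the Poitou–Tate family `(inv, hperf, hsum, hunro, hcompl)` REPLACED by the single named fact
`hPT : poitouTate_selmerStructure_duality ℚ` (one family with local Tate duality, (PT),
Milne I 2.6 and Howard 2.1.11; `inv` enters no other binder); the instance binder `[Finite E[3]]`
KEPT (the statement's `HasCanonicalComparison` / PORT live on the `𝔽₃`-module `E[3]`; discharge by
`finite_torsionPoints_holds`).  For `W/ℚ` globally minimal, additive at `3` with `3 ∤ c₃`,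
`ρ̄_{E,3}` onto, `E(ℚ₃)[3] = 0`, `r_an = 0`, `3 ∤ #Ш_an`, a `τ`-datum at level `3`, Tate's `hEP`,
an admissible `S`, a Kolyvagin datum `D` on `E[3]` for `𝒫(τ)` with cyclotomic transverse conditions
and canonical comparison maps, `v₃ ∣ 3`, THE PORT `KatoKuriharaDictionaryThreeOneAt W 0 D v₃`, and a
modular parametrisation `P` with `3 ∤ c_P`, the `3`-adic unit period transfer and `[0]⁺` a `3`-adic
unit: `BSD(E, 3)`.  Chain: DICT3₁ → Kato classes → p266233
`apply_empty_not_mem_selmerGroup_kummer_of_dictionary` (certificate) → p265535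
`natCard_selmerGroup_three_eq_one_of_levelOne_certificate` (`#Sel^(3) = 1`) → the GZK-free
consumer.  NO tower, NO (im), NO GZK.  EXOTIC rows REDUCED (to DICT3₁ + `hS24`, `hS24₂`, `hPT`,
`hEP`), none closed; nothing booked; no mark / label changed.
[cite: Kim2022StructureSelmer, Thm. 3.13] [cite: Sakamoto2024, Thm. 4.4 (p. 926)]
[cite: MilneADT2006, Ch. I, Thm. 4.10(b)] [cite: Miller2011LMS, §1 and Def. 1.1] -/
theorem bsdp_three_of_dictionaryOne_of_facts [W.IsGloballyMinimal]
    (hS24 : Sakamoto2024.kolyvaginSystems_freeRankOne_zmod_three_pow)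
    (hS24₂ : Sakamoto2024.kolyvaginSystems_idealOfBasis_eq_fittingIdeal_zmod_three_pow)
    (hPT : poitouTate_selmerStructure_duality ℚ)
    (hEP : ∀ v : HeightOneSpectrum (𝓞 ℚ), localEulerPoincareCharacteristic (v.adicCompletion ℚ))
    [Finite (geomTorsion W ((3 : ℕ) : ℤ))]
    (hX : Addv W 3) (hc3 : ¬ 3 ∣ (W.baseChange ℚ_[3]).localTamagawaNumber ℤ_[3])
    (h3 : W.HasSurjectiveModNGaloisRep ((3 : ℕ) : ℤ)) (hr : W.analyticRank = 0)
    (ht : Nat.card {Q : (W.baseChange ℚ_[3]).toAffine.Point // (3 : ℕ) • Q = 0} = 1)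
    {q : ℚ} (hq : shaAn W = (q : ℂ)) (hv : padicValRat 3 q = 0)
    (τ : absoluteGaloisGroup ℚ) (hτμ : τ ∈ rootsOfUnityFixer ℚ 3)
    (hτq : Nonempty (cokerSubOne (W.torsionGaloisModule ((3 : ℕ) : ℤ)) τ ≃+ ZMod 3))
    (S : Finset (Place ℚ)) (hS : ∀ w : InfinitePlace ℚ, (Sum.inl w : Place ℚ) ∈ S)
    (h3S : ∀ v : HeightOneSpectrum (𝓞 ℚ), ((3 : ℕ) : 𝓞 ℚ) ∈ v.asIdeal → (Sum.inr v : Place ℚ) ∈ S)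
    (hbadS : ∀ v : HeightOneSpectrum (𝓞 ℚ), ¬ W.HasGoodReductionAt v → (Sum.inr v : Place ℚ) ∈ S)
    (D : KolyvaginDatum (W.torsionGaloisModule ((3 : ℕ) : ℤ)))
    (η : (q : HeightOneSpectrum (𝓞 ℚ)) → (ZMod (Ideal.absNorm q.asIdeal))ˣ)
    (hP : D.primes = frobeniusClassPrimes (W.torsionGaloisModule ((3 : ℕ) : ℤ))
      {v | (Sum.inr v : Place ℚ) ∈ S} τ 3)
    (hT : D.transverse = cyclotomicTransverse (W.torsionGaloisModule ((3 : ℕ) : ℤ)))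
    (hD : D.HasCanonicalComparison 3 η)
    (v₃ : HeightOneSpectrum (𝓞 ℚ)) (hv₃ : ((3 : ℕ) : 𝓞 ℚ) ∈ v₃.asIdeal)
    (hDict : KatoKuriharaDictionaryThreeOneAt W 0 D v₃)
    {N : ℕ} [NeZero N] (P : ModularParametrizationData W N)
    (hManin : ¬ ((3 : ℕ) : ℤ) ∣ P.maninConstant)
    (hΩ : ∃ u : ℚ, ‖(u : ℚ_[3])‖ = 1 ∧ W.realPeriodRat = u * plusPeriod P.f)
    (hunit : ratModP 3 (ratPlusSymbol P.f 0) ≠ 0) :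
    BSDp W 3 := by
  haveI : Fact (Nat.Prime 3) := ⟨Nat.prime_three⟩
  -- the Poitou–Tate family from the named fact
  obtain ⟨inv, hperf, hsum, hunro, hcompl⟩ := hPT 3
  -- the dictionary at `∅`: Kato-type classes with a unit value
  obtain ⟨κ₀, Λ, -, ⟨κ', hI4⟩, -, hΛker, hdict⟩ :=
    hDict hX hc3 h3 (by rw [ht, pow_zero]) hv₃ P hManin hΩ
  obtain ⟨u, ψ, -, hval⟩ := hdict ∅ D.isLevel_empty
  rw [kuriharaNumber_eq_ratModP_of_eq_one P.f 3 _ _ Finset.prod_empty ψ] at hval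
  -- the level-one certificate and `#Sel^(3) = 1`
  have hcert := apply_empty_not_mem_selmerGroup_kummer_of_dictionary W v₃ κ₀ κ' hI4 Λ hΛker hval rfl hunit
  have hsel : Nat.card (W.selmerGroup (3 : ℤ)) = 1 :=
    natCard_selmerGroup_three_eq_one_of_levelOne_certificate W hS24 hS24₂ h3 τ hτμ hτq inv hperf hsum
      hunro hcompl hEP S hS h3S hbadS D η hP hT hD κ' hcert
  -- the GZK-free consumer
  exact bsdp_of_card_selmerGroup_eq_one_of_analyticRank_eq_zero W 3 hr hq hv (by exact_mod_cast hsel)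

/-- **The same with `S`, `τ`, `η`, the datum `D` and the place `v₃` discharged existentially — the
EXOTIC unit case from NAMED FACTS + ROW CONDITIONS + THE PORT alone.**  On an additive `3 ∤ c₃`,
surj(3), `E(ℚ₃)[3] = 0`, `r_an = 0`, `3 ∤ #Ш_an` row of a globally minimal `W/ℚ` with a modular
parametrisation `P`, `3 ∤ c_P`, the unit period transfer and a `3`-adic unit `[0]⁺`, granted the
named facts `hS24`, `hS24₂` ([S24] Thm. 4.4), `hPT` (Poitou–Tate for Selmer structures) and `hEP`
(Tate), THERE ARE an admissible `S` (x11b `KummerPT.exists_exceptional_finset`), `τ` (p260356, from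
surj(3)), `η`, `D` (n1011-p04 T-HCC) and `v₃ ∣ 3` such that the level-one dictionary
`KatoKuriharaDictionaryThreeOneAt W 0 D v₃` ALONE implies `BSD(E, 3)`.  Binders of record: four
named facts, six row conditions, the modular-parametrisation data, the instance `[Finite E[3]]`,
THE PORT.  Nothing booked;
EXOTIC rows REDUCED, none closed; no mark / label changed.
[cite: Kim2022StructureSelmer, Thm. 3.13] [cite: Sakamoto2024, Thm. 4.4 (p. 926)]
[cite: MilneADT2006, Ch. I, Thm. 4.10(b)] -/
theorem exists_kolyvaginDatum_bsdp_three_of_dictionaryOne_of_facts [W.IsGloballyMinimal]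
    (hS24 : Sakamoto2024.kolyvaginSystems_freeRankOne_zmod_three_pow)
    (hS24₂ : Sakamoto2024.kolyvaginSystems_idealOfBasis_eq_fittingIdeal_zmod_three_pow)
    (hPT : poitouTate_selmerStructure_duality ℚ)
    (hEP : ∀ v : HeightOneSpectrum (𝓞 ℚ), localEulerPoincareCharacteristic (v.adicCompletion ℚ))
    [Finite (geomTorsion W ((3 : ℕ) : ℤ))]
    (hX : Addv W 3) (hc3 : ¬ 3 ∣ (W.baseChange ℚ_[3]).localTamagawaNumber ℤ_[3])
    (h3 : W.HasSurjectiveModNGaloisRep ((3 : ℕ) : ℤ)) (hr : W.analyticRank = 0)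
    (ht : Nat.card {Q : (W.baseChange ℚ_[3]).toAffine.Point // (3 : ℕ) • Q = 0} = 1)
    {q : ℚ} (hq : shaAn W = (q : ℂ)) (hv : padicValRat 3 q = 0)
    {N : ℕ} [NeZero N] (P : ModularParametrizationData W N)
    (hManin : ¬ ((3 : ℕ) : ℤ) ∣ P.maninConstant)
    (hΩ : ∃ u : ℚ, ‖(u : ℚ_[3])‖ = 1 ∧ W.realPeriodRat = u * plusPeriod P.f)
    (hunit : ratModP 3 (ratPlusSymbol P.f 0) ≠ 0) :
    ∃ (S : Finset (Place ℚ)) (τ : absoluteGaloisGroup ℚ)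
      (η : (q : HeightOneSpectrum (𝓞 ℚ)) → (ZMod (Ideal.absNorm q.asIdeal))ˣ)
      (D : KolyvaginDatum (W.torsionGaloisModule ((3 : ℕ) : ℤ))) (v₃ : HeightOneSpectrum (𝓞 ℚ)),
      (∀ w : InfinitePlace ℚ, (Sum.inl w : Place ℚ) ∈ S) ∧
      (∀ v : HeightOneSpectrum (𝓞 ℚ), ((3 : ℕ) : 𝓞 ℚ) ∈ v.asIdeal → (Sum.inr v : Place ℚ) ∈ S) ∧
      (∀ v : HeightOneSpectrum (𝓞 ℚ), ¬ W.HasGoodReductionAt v → (Sum.inr v : Place ℚ) ∈ S) ∧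
      τ ∈ rootsOfUnityFixer ℚ 3 ∧
      Nonempty (cokerSubOne (W.torsionGaloisModule ((3 : ℕ) : ℤ)) τ ≃+ ZMod 3) ∧
      D.primes = frobeniusClassPrimes (W.torsionGaloisModule ((3 : ℕ) : ℤ))
        {v | (Sum.inr v : Place ℚ) ∈ S} τ 3 ∧
      D.transverse = cyclotomicTransverse (W.torsionGaloisModule ((3 : ℕ) : ℤ)) ∧
      D.HasCanonicalComparison 3 η ∧ ((3 : ℕ) : 𝓞 ℚ) ∈ v₃.asIdeal ∧
      (KatoKuriharaDictionaryThreeOneAt W 0 D v₃ → BSDp W 3) := by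
  haveI : Fact (Nat.Prime 3) := ⟨Nat.prime_three⟩
  obtain ⟨S, -, hS, h3S, hbadS⟩ := X11b.KummerPT.exists_exceptional_finset W 3 (∅ : Finset (Place ℚ))
  obtain ⟨τ, hτ, hτq⟩ := exists_rootsOfUnityFixer_cokerSubOne_equiv_zmod_three_of_surj W h3
  have hτμ : τ ∈ rootsOfUnityFixer ℚ 3 := hτ 3 (by norm_num)
  obtain ⟨η, D, hP, hT, hD⟩ :=
    FSComp.exists_eta_kolyvaginDatum_hasCanonicalComparison_frobeniusClassPrimes
      (W.torsionGaloisModule ((3 : ℕ) : ℤ)) 3 {v | (Sum.inr v : Place ℚ) ∈ S} hτμ hτq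
      (cyclotomicTransverse (W.torsionGaloisModule ((3 : ℕ) : ℤ)))
  let v₃ : HeightOneSpectrum (𝓞 ℚ) := (Rat.HeightOneSpectrum.primesEquiv (R := 𝓞 ℚ)).symm ⟨3, Nat.prime_three⟩
  have hv₃ : ((3 : ℕ) : 𝓞 ℚ) ∈ v₃.asIdeal := three_mem_primesEquiv_symm_three
  exact ⟨S, τ, η, D, v₃, hS, h3S, hbadS, hτμ, hτq, hP, hT, hD, hv₃, fun hDict =>
    bsdp_three_of_dictionaryOne_of_facts W hS24 hS24₂ hPT hEP hX hc3 h3 hr ht hq hv τ hτμ hτq S hS h3S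
      hbadS D η hP hT hD v₃ hv₃ hDict P hManin hΩ hunit⟩

/-! ### ONE PORT, TWO SPELLINGS: DICT3 at `k = 0` in n1011-p09's level spelling IS DICT3₁ -/

/-- **`𝓕_can` on `E[3^0·3]` is `𝓕_can` on `E[3]`, definitionally** (the level-`0` datum
`π_{0+1} : T_3E → E[3^0·3]` of `propagatedSelmerStructure W 3 0` and the datum `π_1 : T_3E → E[3]` of
`propagatedSelmerStructureOne W 3` coincide: `(3:ℤ)^0·3` and `3` are the same integer by evaluation).
[folklore] -/
theorem propagatedSelmerStructure_three_zero :
    propagatedSelmerStructure W 3 0 = propagatedSelmerStructureOne W 3 := rfl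

/-- **ONE PORT, TWO SPELLINGS (route planner r1's rider R-a, now a kernel `Iff.rfl`).**  n1011-p09's
R1-21 port `KatoKuriharaDictionaryThreeAt W k t D v₃` (p262039, level spelling: `E[3^k·3]`,
`propagatedSelmerStructure W 3 k`, `ℤ/3^(k+1)`, `δ̃` at `3^(k+1)`) AT `k = 0` and p13's `E[3]`-literal
twin `KatoKuriharaDictionaryThreeOneAt W t D v₃` (p271070: `E[3]`, `propagatedSelmerStructureOne W 3`,
`ℤ/3`, `δ̃` at `3`) are the SAME proposition — definitionally: `(3:ℤ)^0·3 = 3`, `3^(0+1) = 3` by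
evaluation, and the two propagated structures agree (`propagatedSelmerStructure_three_zero`).  So the
cell's input ledger carries ONE debt line DICT3 (flag `K22-Thm3.13-PORT@3`), not two, as a theorem
and not only as a convention. [cite: Kim2022StructureSelmer, Thm. 3.13 and §3.3–§3.4.1 (arXiv pp. 17–18)] -/
theorem katoKuriharaDictionaryThreeAt_zero_iff_threeOneAt [W.IsGloballyMinimal] (t : ℕ)
    (D : KolyvaginDatum (W.torsionGaloisModule ((3 : ℕ) : ℤ))) (v₃ : HeightOneSpectrum (𝓞 ℚ)) :
    KatoKuriharaDictionaryThreeAt W 0 t D v₃ ↔ KatoKuriharaDictionaryThreeOneAt W t D v₃ :=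
  Iff.rfl

/-- **The EXOTIC unit case from n1011-p09's port at depth `k = 0`, named facts only, no GZK** — the
`∃`-form `exists_kolyvaginDatum_bsdp_three_of_dictionaryOne_of_facts` read through
`katoKuriharaDictionaryThreeAt_zero_iff_threeOneAt`: on an additive `3 ∤ c₃`, surj(3), `E(ℚ₃)[3] = 0`,
`r_an = 0`, `3 ∤ #Ш_an` row (globally minimal `W`, modular parametrisation `P` with `3 ∤ c_P`, unit
period transfer, `[0]⁺` a `3`-adic unit), granted `hS24`, `hS24₂`, `hPT`, `hEP`, there are `S, τ, η, D,
v₃` such that `KatoKuriharaDictionaryThreeAt W 0 0 D v₃ → BSD(E, 3)`.  Route R1-21's predicate thus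
has a direct end-to-end consumer at its bottom level.  Nothing booked; EXOTIC rows REDUCED, none
closed. [cite: Kim2022StructureSelmer, Thm. 3.13] [cite: Sakamoto2024, Thm. 4.4 (p. 926)] -/
theorem exists_kolyvaginDatum_bsdp_three_of_dictionaryAt_zero_of_facts [W.IsGloballyMinimal]
    (hS24 : Sakamoto2024.kolyvaginSystems_freeRankOne_zmod_three_pow)
    (hS24₂ : Sakamoto2024.kolyvaginSystems_idealOfBasis_eq_fittingIdeal_zmod_three_pow)
    (hPT : poitouTate_selmerStructure_duality ℚ)
    (hEP : ∀ v : HeightOneSpectrum (𝓞 ℚ), localEulerPoincareCharacteristic (v.adicCompletion ℚ))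
    [Finite (geomTorsion W ((3 : ℕ) : ℤ))]
    (hX : Addv W 3) (hc3 : ¬ 3 ∣ (W.baseChange ℚ_[3]).localTamagawaNumber ℤ_[3])
    (h3 : W.HasSurjectiveModNGaloisRep ((3 : ℕ) : ℤ)) (hr : W.analyticRank = 0)
    (ht : Nat.card {Q : (W.baseChange ℚ_[3]).toAffine.Point // (3 : ℕ) • Q = 0} = 1)
    {q : ℚ} (hq : shaAn W = (q : ℂ)) (hv : padicValRat 3 q = 0)
    {N : ℕ} [NeZero N] (P : ModularParametrizationData W N)
    (hManin : ¬ ((3 : ℕ) : ℤ) ∣ P.maninConstant)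
    (hΩ : ∃ u : ℚ, ‖(u : ℚ_[3])‖ = 1 ∧ W.realPeriodRat = u * plusPeriod P.f)
    (hunit : ratModP 3 (ratPlusSymbol P.f 0) ≠ 0) :
    ∃ (S : Finset (Place ℚ)) (τ : absoluteGaloisGroup ℚ)
      (η : (q : HeightOneSpectrum (𝓞 ℚ)) → (ZMod (Ideal.absNorm q.asIdeal))ˣ)
      (D : KolyvaginDatum (W.torsionGaloisModule ((3 : ℕ) : ℤ))) (v₃ : HeightOneSpectrum (𝓞 ℚ)),
      (∀ w : InfinitePlace ℚ, (Sum.inl w : Place ℚ) ∈ S) ∧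
      (∀ v : HeightOneSpectrum (𝓞 ℚ), ((3 : ℕ) : 𝓞 ℚ) ∈ v.asIdeal → (Sum.inr v : Place ℚ) ∈ S) ∧
      (∀ v : HeightOneSpectrum (𝓞 ℚ), ¬ W.HasGoodReductionAt v → (Sum.inr v : Place ℚ) ∈ S) ∧
      τ ∈ rootsOfUnityFixer ℚ 3 ∧
      Nonempty (cokerSubOne (W.torsionGaloisModule ((3 : ℕ) : ℤ)) τ ≃+ ZMod 3) ∧
      D.primes = frobeniusClassPrimes (W.torsionGaloisModule ((3 : ℕ) : ℤ))
        {v | (Sum.inr v : Place ℚ) ∈ S} τ 3 ∧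
      D.transverse = cyclotomicTransverse (W.torsionGaloisModule ((3 : ℕ) : ℤ)) ∧
      D.HasCanonicalComparison 3 η ∧ ((3 : ℕ) : 𝓞 ℚ) ∈ v₃.asIdeal ∧
      (KatoKuriharaDictionaryThreeAt W 0 0 D v₃ → BSDp W 3) :=
  exists_kolyvaginDatum_bsdp_three_of_dictionaryOne_of_facts W hS24 hS24₂ hPT hEP hX hc3 h3 hr ht hq hv P
    hManin hΩ hunit

end Summit.BirchSwinnertonDyer.Rank1Residual.GaloisImage

end
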